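import Summits.Ventures.Crystal3D.Theorems.StickyWulffConstantCoaxialWallLawCanonicalLensType
import HarnessLib

/-!
# Definitions M: the MONO-MODULE / MULTI-GRAIN split of the T4 target `TailResidue.LensSoundness`
# (crux `CoaxialWallLaw`, stmt-Ventures-19481; cf-p1 DECISION (cxxxii) «T4 SPLIT (O1) = GO»; memo HOME/wall-19481-p2/F-TAIL-g10.md)

HONEST FRAMING. Venture `Summits/Ventures/Crystal3D` (cell `crystal3d-full`); DEFINITIONS ONLY for the crux `CoaxialWallLaw`
(stmt-Ventures-19481, `route-Ventures-StickyWulffConstant`), registered line 'CoaxialWallLawCertificates' (planner cf-p1).  Nothing is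
claimed; F-C1 not moved.  WHY: `LensSoundness` (…TailResidueDefsL) is closable by the canonical type `typeOf` (…CanonicalLensType,
…LensSoundnessReduction `lens_witness_of_hD`) exactly on windows whose readers near the payer are CAPTURED by ONE standard placement;
the (A)-row admits every chain class (`PlateSystem.Adm`: the multiply-twinned orientations `L·⟨M_{n₁(r)}, M_{ñ(r)}⟩` about each root's
`⟨110⟩` axis), so windows with a second reader grain not co-expressible in the placement (Σ9 grains, incoherently offset Σ3 twins, two
junctions) are outside the lens-type language (F-TAIL-g10 §1–§3; numerics §4/§4′: summand ≤ 1.7 there).  The split, payer transported to `0`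
by the rigid motion `x ↦ S⁻¹x − S⁻¹z` (the convention of `…OnSiteBridge`), frame `L̃ = L.trans S.symm`:
* `shifted S z X` — the transported configuration; `exactPos` — the EXACT POSITIONS of the placement (module sites of `siteBall`, first-
  generation apex positions of `apexBall`), so that `exactOf X̃ = {x ∈ X̃ | x ∈ exactPos}`; `InspectedAt G q b x` — `x` sits at a position
  the automaton inspects for the pair `(b, q)` in the class frame `G`: a dozen or mirrored-dozen position of `q` or of `b`;
* **`MonoModuleAt L X z`** (geometric) — for SOME placement, every (A)-end pair `(b, q)` within `1` of the payer (any witnessing class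
  `(G, d)` of the joint systems of `L̃`) has `q`, `b` and every inspected ball of the window at exact positions;
* **`CapturedAt L X z`** (typing) — for SOME placement and SOME standard frame `L₀`, every such (A)-end pair of `X̃` is a FLAT end pair
  of the exact part `exactOf X̃` for the joint systems of `L₀` (verbatim the hypothesis `hD` of `lens_witness_of_hD`, systems changed to a
  standard placement);
* **`MonoCapture`** — on captured off-site windows, the second disjunct of `LensSoundness` (or a deletion) holds  [closed by
  `…TailResidueMonoCapture`: transport + decoration + `typeOf`];
* **`ModuleCapture`** — `MonoModuleAt ⇒ CapturedAt` on off-site payer windows: the GENERALIZED CLASS COLLAPSE (all firing classes of the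
  `L̃`-systems near one payer, whose frames are standard by the frame lemma, are classes of ONE standard placement's joint systems —
  immediate when `L̃` is itself standard, a `W_r`-word/denominator argument when `L̃` is deep) + position bookkeeping;
* **`MultiGrainSmall s`** — on off-site windows that are NOT mono-module, a deletion lands on-site or the joint summand is `≤ s`
  (the seam regime; any proof through a fixed anchor type of certified row `≥ s₀` gives every `s ≥ s₀`; register `s = 2√6`).
`…TailResidueClosingM`: `LensCert s → MonoCapture → ModuleCapture → MultiGrainSmall s → EndRowJointTailA v2 s 𝒰_cx → … → CoaxialWallLaw`.
WHAT THIS IS NOT: no proof; `LensCert` unchanged (it is the mono half); F-C1 not moved.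
-/

noncomputable section

namespace Summit.Ventures.Crystal3D.Theorems

namespace TailResidue

open Summit.Ventures.Crystal3D Finset
open scoped InnerProductSpace

/-! ### Transport to the payer, exact positions, inspected positions -/

/-- The window transported so that the payer `z` goes to the origin: `x ↦ S⁻¹ x − S⁻¹ z` (the motion of `…OnSiteBridge`). -/
def shifted (S : EuclideanSpace ℝ (Fin 3) ≃ₗᵢ[ℝ] EuclideanSpace ℝ (Fin 3)) (z : EuclideanSpace ℝ (Fin 3))
    (X : Finset (EuclideanSpace ℝ (Fin 3))) : Finset (EuclideanSpace ℝ (Fin 3)) :=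
  X.image fun x => S.symm x + -S.symm z

/-- **The EXACT POSITIONS of the placement** (module coordinates): module sites of `siteBall` and first-generation apex positions of
`apexBall` — the positions at which a ball is an exact ball of `typeOf` (`exactOf X̃ = X̃ ∩ exactPos`). -/
def exactPos : Set (EuclideanSpace ℝ (Fin 3)) :=
  (modSite '' (↑siteBall : Set (ℤ × ℤ × ℤ))) ∪ (fineVec '' (↑apexBall : Set (ℤ × ℤ × ℤ)))

/-- **INSPECTED POSITION** for the pair `(b, q)` in the class frame `G`: `x` is a dozen position or a mirrored-dozen position (mirror
across a menu normal of `G`) of the mover `q` or of the target `b` — the points whose presence or absence the automaton's predicates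
`IsFull / IsTwinReading / IsNarrow / IsMoving` read when deciding `IsEndMove X v G d q b` (predecessor `q − d = q + G(−w)` included). -/
def InspectedAt (G : EuclideanSpace ℝ (Fin 3) ≃ₗᵢ[ℝ] EuclideanSpace ℝ (Fin 3)) (q b x : EuclideanSpace ℝ (Fin 3)) : Prop :=
  ∃ w ∈ fccSlots, x = q + G w ∨ x = b + G w ∨
    ∃ m, IsMenuNormal G m ∧ (x = q + (G w - (2 * ⟪G w, m⟫_ℝ) • m) ∨ x = b + (G w - (2 * ⟪G w, m⟫_ℝ) • m))

/-! ### The split -/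

/-- **MONO-MODULE WINDOW (geometric)**: for some placement `S` (payer to `0`, frame `L̃ = L.trans S.symm`), every (A)-end pair `(b, q)`
of the transported window within `1` of the payer, through ANY witnessing class `(G, d)` of the joint systems of `L̃`, has its mover, its
target and every inspected ball of the window at exact positions.  Windows with a second reader grain (not co-expressible) fail this. -/
def MonoModuleAt (L : EuclideanSpace ℝ (Fin 3) ≃ₗᵢ[ℝ] EuclideanSpace ℝ (Fin 3)) (X : Finset (EuclideanSpace ℝ (Fin 3)))
    (z : EuclideanSpace ℝ (Fin 3)) : Prop :=
  ∃ S : EuclideanSpace ℝ (Fin 3) ≃ₗᵢ[ℝ] EuclideanSpace ℝ (Fin 3),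
    ∀ b q : EuclideanSpace ℝ (Fin 3), ∀ G : EuclideanSpace ℝ (Fin 3) ≃ₗᵢ[ℝ] EuclideanSpace ℝ (Fin 3), ∀ d : EuclideanSpace ℝ (Fin 3),
      dist (0 : EuclideanSpace ℝ (Fin 3)) b ≤ 1 → q ∈ shifted S z X → b ∈ shifted S z X →
      ((basalSystem (L.trans S.symm)).Adm G d ∨
        (basalSystem (((ℝ ∙ EuclideanSpace.single (2 : Fin 3) (1 : ℝ)).reflection).trans (L.trans S.symm))).Adm G d) →
      q - d ∈ shifted S z X → IsEndMove (shifted S z X) WordVersion.v2 G d q b →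
        q ∈ exactPos ∧ b ∈ exactPos ∧ ∀ x ∈ shifted S z X, InspectedAt G q b x → x ∈ exactPos

/-- **CAPTURED WINDOW (typing)**: for some placement `S` and some STANDARD frame `L₀`, every (A)-end pair of the transported window within
`1` of the payer (joint systems of `L̃ = L.trans S.symm`) is a FLAT end pair of the exact part `exactOf` for the joint systems of `L₀` —
the hypothesis under which the canonical type dominates the summand (`lens_witness_of_hD`, systems moved to a standard placement). -/
def CapturedAt (L : EuclideanSpace ℝ (Fin 3) ≃ₗᵢ[ℝ] EuclideanSpace ℝ (Fin 3)) (X : Finset (EuclideanSpace ℝ (Fin 3)))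
    (z : EuclideanSpace ℝ (Fin 3)) : Prop :=
  ∃ S : EuclideanSpace ℝ (Fin 3) ≃ₗᵢ[ℝ] EuclideanSpace ℝ (Fin 3), ∃ L₀ : EuclideanSpace ℝ (Fin 3) ≃ₗᵢ[ℝ] EuclideanSpace ℝ (Fin 3),
    StdFrame L₀ ∧ ∀ b q : EuclideanSpace ℝ (Fin 3), dist (0 : EuclideanSpace ℝ (Fin 3)) b ≤ 1 →
      IsEndPairA (shifted S z X) WordVersion.v2 (basalSystem (L.trans S.symm))
        (basalSystem (((ℝ ∙ EuclideanSpace.single (2 : Fin 3) (1 : ℝ)).reflection).trans (L.trans S.symm))) b q →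
      IsEndPairFlat (exactOf (shifted S z X)) WordVersion.v2 (basalSystem L₀)
        (basalSystem (((ℝ ∙ EuclideanSpace.single (2 : Fin 3) (1 : ℝ)).reflection).trans L₀)) b q

open scoped Classical in
/-- **MONO CAPTURE (the canonical-typing half of T4)**: at every payer window of a `1`-separated configuration that is not on-site for
𝒰_cx and IS captured, a deletion of inessential balls lands on-site or the joint summand is bounded by the row of a well-formed realisable
lens type at a standard placement. -/
def MonoCapture : Prop :=
  ∀ L : EuclideanSpace ℝ (Fin 3) ≃ₗᵢ[ℝ] EuclideanSpace ℝ (Fin 3),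
  ∀ X : Finset (EuclideanSpace ℝ (Fin 3)), (∀ p ∈ X, ∀ q ∈ X, p ≠ q → 1 ≤ dist p q) →
  ∀ z ∈ X, (X.filter fun q => dist z q = 1).card ≤ 11 → ¬ OnSiteAt coaxialModuleUniverse X z → CapturedAt L X z →
    HasDeletionOnSite X z ∨ ∃ τ : LensType, τ.WellFormed ∧ τ.Realisable ∧
      ∃ L₀ : EuclideanSpace ℝ (Fin 3) ≃ₗᵢ[ℝ] EuclideanSpace ℝ (Fin 3), StdFrame L₀ ∧
        localSummandA WordVersion.v2 (basalSystem L)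
          (basalSystem (((ℝ ∙ EuclideanSpace.single (2 : Fin 3) (1 : ℝ)).reflection).trans L)) X z ≤ τ.row L₀

open scoped Classical in
/-- **MODULE CAPTURE (generalized class collapse + positions)**: a mono-module off-site payer window is captured. -/
def ModuleCapture : Prop :=
  ∀ L : EuclideanSpace ℝ (Fin 3) ≃ₗᵢ[ℝ] EuclideanSpace ℝ (Fin 3),
  ∀ X : Finset (EuclideanSpace ℝ (Fin 3)), (∀ p ∈ X, ∀ q ∈ X, p ≠ q → 1 ≤ dist p q) →
  ∀ z ∈ X, (X.filter fun q => dist z q = 1).card ≤ 11 → ¬ OnSiteAt coaxialModuleUniverse X z →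
    MonoModuleAt L X z → CapturedAt L X z

open scoped Classical in
/-- **MULTI-GRAIN SMALLNESS at the line `s` (the seam regime of T4)**: at every off-site payer window that is NOT mono-module, a
deletion of inessential balls lands on-site or the joint summand of `L` is `≤ s`.  Register `s = 2√6`; numerics (F-TAIL-g10 §4′,
kit j326890): `≤ 1.7` on 5 376 bi-grain windows. -/
def MultiGrainSmall (s : ℝ) : Prop :=
  ∀ L : EuclideanSpace ℝ (Fin 3) ≃ₗᵢ[ℝ] EuclideanSpace ℝ (Fin 3),
  ∀ X : Finset (EuclideanSpace ℝ (Fin 3)), (∀ p ∈ X, ∀ q ∈ X, p ≠ q → 1 ≤ dist p q) →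
  ∀ z ∈ X, (X.filter fun q => dist z q = 1).card ≤ 11 → ¬ OnSiteAt coaxialModuleUniverse X z → ¬ MonoModuleAt L X z →
    HasDeletionOnSite X z ∨
      localSummandA WordVersion.v2 (basalSystem L)
        (basalSystem (((ℝ ∙ EuclideanSpace.single (2 : Fin 3) (1 : ℝ)).reflection).trans L)) X z ≤ s

/-- `MultiGrainSmall` is monotone in the line. -/
theorem multiGrainSmall_mono {s t : ℝ} (hst : s ≤ t) (h : MultiGrainSmall s) : MultiGrainSmall t := by
  intro L X hX z hz hdeg hoff hM
  rcases h L X hX z hz hdeg hoff hM with h' | h'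
  · exact Or.inl h'
  · exact Or.inr (h'.trans hst)

end TailResidue

end Summit.Ventures.Crystal3D.Theorems

end
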